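import Literature.MathematicalPhysics.QuantumFieldTheory.Balaban1983to89.LatticeFieldCalculus
import Literature.MathematicalPhysics.QuantumFieldTheory.Balaban1983to89.B7SectAStatements

/-!
# `Balaban1983to89.B4Eq15Projection` — T. Bałaban, *Regularity and decay of lattice Green's functions*, Commun. Math. Phys.
**89** (1983) 571–597 [Balaban1983RegularityDecay]: the adjoint `Q_k^*(A)` of the covariant averaging operator (1.4) and the
projection operator `P_k(A) = Q_k^*(A) Q_k(A)` (1.5), p. 572, on the carriers OF RECORD (V1)

statement-level skeleton of published theorems with citation tags; proofs where landed; nothing here is a claim about the Yang–Mills mass gap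

PDF held: `paper:balaban1983-cmp89-regularity-decay` (journal page = PDF page + 570).  Page read as an image by this seat:
`run/shared/lean/pub/pub-balaban/b2b-balaban-ref1/pages/1983-cmp89-regularity-decay/1983-cmp89-regularity-decay-p002-x2.png` (p. 572).

CITATION HEADER (lean-in-tree rule).  This module is part of the lit-balaban TYPED SKELETON (HOME `run/shared/lean/pub/lit-balaban/`);
WHAT IS REPRODUCED = SKELETON.md row `B4.Eq1.4-1.5` (reader r18 id A12; PHASE2-TARGETS.md §G.3 seat p35 = reserve R8).  PRINT, verbatim,
p. 572 [PDF 2]: "Next let us define some projection operators in the space of functions `φ`. At first we define a covariant averaging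
operator `(Q_k(A)φ)(y) = Σ_{x ∈ B^k(y)} η^d U(A(Γ^{(k)}_{y,x})) φ(x)`, `y ∈ Z^d`. (1.4)  Here `Γ^{(k)}_{y,x}`, `x ∈ B^k(y)`, are oriented
contours in `B^k(y)` connecting the initial point `y` with a final point `x`. For an arbitrary contour `Γ` in the lattice `ηZ^d`
(considered as a sum of bonds) we define `A(Γ) = Σ_{b ⊂ Γ} A_b`, where orientations of the bonds `b` agree with orientation of the
contour `Γ`. The projection operator `P_k(A)` is given by `P_k(A) = Q_k^*(A) Q_k(A)`. (1.5)"; (1.2) p. 572: "`U(A) = e^{qeηA}`, `q` is an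
antisymmetric `N × N` matrix, where `e` is a real parameter"; `η = L^{-k}` (p. 572, l. 2), so `η^d = L^{-dk} = |B^k(y)|^{-1}`.

WHAT IS TYPED AND HOW.  On the tori `T^{(i)}` of `…Balaban1983to89.Setup` (`Site P i`, fields `SiteField P i W` with values in a
real inner-product space `W` — `R^N` in [B4]), with the blocks of order `k` `B^k(y) = B7SectAStatements.blockJ k y` (`|B^k(y)| = L^{dk}`
in the standing range `i + k ≤ m + K`, `B7SectAStatements.card_blockJ`) and the `η^d`-weighted `ℓ²` pairings `LatticeNorms.l2Inner`
([Balaban1985Averaging] (18)):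
* §1 `embIter k y`: the point `y` of the unit lattice `T^{(i+k)}` as a site of the fine lattice `T^{(i)}` (the `k`-fold iterate of
  `Setup.emb`; the initial point of `Γ^{(k)}_{y,x}`), with `embIter k y ∈ B^k(y)`.
* §2 the operator (1.4) `covAvgK k T` for an ARBITRARY system of parallel transporters `T y x : W →ₗ[ℝ] W` (print: `U(A(Γ^{(k)}_{y,x}))`
  for the user's choice of the contours `Γ^{(k)}_{y,x}`, which (1.4) leaves open), its ADJOINT `covAvgKAdj k T` in the pairings
  `⟨·,·⟩` of `T^{(i)}` (weight `w = η^d`) and of `T^{(i+k)}` (weight `L^{dk} w`; `= 1` for `w = L^{-dk}` as in (1.4)):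
  `(Q_k^*ψ)(x) = T(y_x, x)^* ψ(y_x)`, `y_x` the block point of `x`, and (1.5) `covProjK k T = Q_k^* ∘ Q_k`.  KERNEL THEOREMS: `Q_k^*` IS
  the adjoint (`l2Inner_covAvgK`); for ORTHOGONAL transporters (`T^* T = 1`, which is (1.2): `q` antisymmetric) `Q_k Q_k^* = 1`
  (`covAvgK_covAvgKAdj`), hence `P_k P_k = P_k`, `P_k Q_k^* = Q_k^*`, `Q_k P_k = Q_k`; `⟨φ, P_k φ'⟩ = ⟨Q_k φ, Q_k φ'⟩`, `P_k` symmetric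
  and `⟨φ, P_k φ⟩ = ‖Q_k φ‖² ≥ 0` — i.e. `P_k(A)` is an orthogonal projection, the content of the words "projection operator" in (1.5).
* §3 [B4]'s transporters from a vector field `A` through a representation `Urep : ℝ → End(W)` (`U(A) = e^{qeηA}`) along the STAIRCASE
  contours of `LatticeFieldCalculus.stairSum` issued from the centre `embIter k y` (`stairTransport`); for `k = 1` this IS the
  one-level covariant average `LatticeFieldCalculus.covSiteAvg` of [Balaban1983RegularityDecay] (1.4) already in the tree
  (`covSiteAvg_eq_covAvgK`, standing range), whence its adjoint `covSiteAvgAdj` and projection `covSiteProj` with the same theorems.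
Conventions inherited (flagged, not adjudicated): CENTRED blocks of `Setup` (`L` odd; [B4] (1.1) anchors `B^k(y)` at the corner `y` —
DIVERGENCE F3 of the audit cell `pub-balaban`; every identity below is insensitive to the anchor and to the choice of contours); the
whole torus in place of a union of big blocks `Ω` ((1.4)–(1.5) act blockwise, so the restriction to `Ω` is the restriction of `y`).
NOT here: (1.6) `G_k(Ω, A)` and anything after it; the matrix-carrier (V2) form of (1.4)–(1.5) is `B4GaugeCovariance.avgOp/projOp`
(counting pairings), not restated.  Elementary finite sums and `LinearMap.adjoint` on a finite-dimensional real inner-product space;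
no analysis.  Unit `lit-balaban-p35` (Phase-2 proof seat p35), 2026-08-21.
-/

open scoped BigOperators InnerProductSpace

namespace Literature.MathematicalPhysics.QuantumFieldTheory.Balaban1983to89

namespace B4Eq15Projection

open LatticeFieldCalculus B7SectAStatements LatticeNorms

/-! ## 1. The unit-lattice point `y` as a site of the fine lattice: the `k`-fold centre embedding -/

section Geometry

variable {P : Params} {i : ℕ}

/-- The point `y ∈ Z^d` (here: of `T^{(i+k)}`) regarded as a point of the fine lattice `ηZ^d` (`T^{(i)}`), `η = L^{-k}` — the
initial point of the contours `Γ^{(k)}_{y,x} ⊂ B^k(y)` of (1.4): the `k`-fold iterate of the one-level inclusion `Setup.emb`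
(centre of the centred block; [B4] (1.1) uses the corner, DIVERGENCE F3). [cite: Balaban1983RegularityDecay, (1.4) p.572] -/
def embIter : (k : ℕ) → Site P (i + k) → Site P i
  | 0, y => y
  | k + 1, y => embIter k (emb y)

/-- `embIter 0 = id`. [cite: Balaban1983RegularityDecay, (1.4) p.572] -/
@[simp] theorem embIter_zero (y : Site P (i + 0)) : embIter 0 y = y := rfl

/-- `embIter (k+1) = embIter k ∘ emb`. [cite: Balaban1983RegularityDecay, (1.4) p.572] -/
@[simp] theorem embIter_succ (k : ℕ) (y : Site P (i + (k + 1))) : embIter (k + 1) y = embIter k (emb y) := rfl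

/-- The initial point `y` of `Γ^{(k)}_{y,x}` lies in `B^k(y)`: the `k`-fold block point of `embIter k y` is `y`
(standing range `i + k ≤ m + K`). [cite: Balaban1983RegularityDecay, (1.4) p.572] -/
theorem blockOfIter_embIter : ∀ (k : ℕ), i + k ≤ P.m + P.K → ∀ y : Site P (i + k), blockOfIter k (embIter k y) = y
  | 0, _, _ => rfl
  | k + 1, hk, y => by
    have hk' : i + k ≤ P.m + P.K := by omega
    have hk1 : i + k + 1 ≤ P.m + P.K := by omega
    rw [embIter_succ, blockOfIter_succ, blockOfIter_embIter k hk' (emb y), Site.blockOf_emb hk1]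

/-- `embIter k y ∈ B^k(y)`. [cite: Balaban1983RegularityDecay, (1.4) p.572] -/
theorem embIter_mem_blockJ {k : ℕ} (hk : i + k ≤ P.m + P.K) (y : Site P (i + k)) : embIter k y ∈ blockJ k y := by
  rw [mem_blockJ, blockOfIter_embIter k hk y]

/-- The sites of `T^{(i)}` are partitioned by the blocks of order `k`: `Σ_x g(x) = Σ_y Σ_{x ∈ B^k(y)} g(x)`. [folklore] -/
private theorem sum_eq_sum_blockJ {α : Type*} [AddCommMonoid α] (k : ℕ) (g : Site P i → α) :
    ∑ x, g x = ∑ y : Site P (i + k), ∑ x ∈ blockJ k y, g x := by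
  rw [← Finset.sum_fiberwise Finset.univ (blockOfIter k) g]
  rfl

end Geometry

/-! ## 2. (1.4) with the parallel transporters as data, its adjoint, and the projection operator (1.5) -/

section Operators

variable {P : Params} {i : ℕ} {W : Type*} [NormedAddCommGroup W] [InnerProductSpace ℝ W]

/-- **(1.4)** p. 572 [PDF 2], verbatim: *"`(Q_k(A)φ)(y) = Σ_{x ∈ B^k(y)} η^d U(A(Γ^{(k)}_{y,x})) φ(x)`, `y ∈ Z^d`"* — typed reading:
the covariant averaging operator of order `k` from fields on `T^{(i)}` to fields on `T^{(i+k)}`, with the parallel transporters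
`T y x = U(A(Γ^{(k)}_{y,x}))` along the user's contours `Γ^{(k)}_{y,x}` supplied as data, `η^d = L^{-dk}` and `B^k(y) = blockJ k y`;
[B4]'s own transporters (`U(A) = e^{qeηA}` along contours in `B^k(y)`) are `stairTransport` (§3). [cite: Balaban1983RegularityDecay, (1.4) p.572] -/
noncomputable def covAvgK (k : ℕ) (T : Site P (i + k) → Site P i → W →ₗ[ℝ] W) (φ : SiteField P i W) :
    SiteField P (i + k) W :=
  fun y => ((((P.L : ℝ) ^ P.d) ^ k)⁻¹) • ∑ x ∈ blockJ k y, T y x (φ x)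

/-- `Q_k` is additive (a linear operator, p. 572 "operators on subsets of the lattice"). [cite: Balaban1983RegularityDecay, (1.4) p.572] -/
theorem covAvgK_add (k : ℕ) (T : Site P (i + k) → Site P i → W →ₗ[ℝ] W) (φ φ' : SiteField P i W) :
    covAvgK k T (φ + φ') = covAvgK k T φ + covAvgK k T φ' := by
  funext y
  simp only [covAvgK, Pi.add_apply, map_add, Finset.sum_add_distrib, smul_add]

/-- `Q_k` is homogeneous. [cite: Balaban1983RegularityDecay, (1.4) p.572] -/
theorem covAvgK_smul (k : ℕ) (T : Site P (i + k) → Site P i → W →ₗ[ℝ] W) (c : ℝ) (φ : SiteField P i W) :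
    covAvgK k T (c • φ) = c • covAvgK k T φ := by
  funext y
  simp only [covAvgK, Pi.smul_apply, map_smul, ← Finset.smul_sum, smul_comm c]

variable [FiniteDimensional ℝ W]

/-- Orthogonality in the isometric form `T^* T = 1` implies the co-isometric form `T T^* = 1` (finite dimension): an isometry of a
finite-dimensional space is invertible with inverse its adjoint. [folklore] -/
private theorem comp_adjoint_eq_id {U : W →ₗ[ℝ] W} (h : LinearMap.adjoint U ∘ₗ U = LinearMap.id) :
    U ∘ₗ LinearMap.adjoint U = LinearMap.id := by
  have hleft : ∀ v, LinearMap.adjoint U (U v) = v := fun v => by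
    simpa using LinearMap.congr_fun h v
  have hinj : Function.Injective U := fun a b hab => by
    rw [← hleft a, ← hleft b, hab]
  have hsurj : Function.Surjective U := LinearMap.surjective_of_injective hinj
  refine LinearMap.ext fun v => ?_
  obtain ⟨u, rfl⟩ := hsurj v
  simp [hleft u]

/-- THE ADJOINT `Q_k^*(A)` of (1.4) entering (1.5), with respect to the scalar products `⟨f, g⟩ = Σ_x η^d f(x)·g(x)` on `ηZ^d`
and `Σ_y f(y)·g(y)` on `Z^d` (generally: weight `w` on `T^{(i)}`, `L^{dk} w` on `T^{(i+k)}`; theorem `l2Inner_covAvgK`):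
`(Q_k^*(A)ψ)(x) = U(A(Γ^{(k)}_{y_x,x}))^* ψ(y_x)`, `y_x` the point with `x ∈ B^k(y_x)` (the weights `L^{dk} w · L^{-dk}` combine to
`w`).  `T^*` = `LinearMap.adjoint` (`= Tᵀ = T⁻¹` for the orthogonal `U(A)` of (1.2)). [cite: Balaban1983RegularityDecay, (1.5) p.572] -/
noncomputable def covAvgKAdj (k : ℕ) (T : Site P (i + k) → Site P i → W →ₗ[ℝ] W) (ψ : SiteField P (i + k) W) :
    SiteField P i W :=
  fun x => LinearMap.adjoint (T (blockOfIter k x) x) (ψ (blockOfIter k x))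

/-- **(1.5)** p. 572 [PDF 2], verbatim: *"The projection operator `P_k(A)` is given by `P_k(A) = Q_k^*(A) Q_k(A)`."* — the
composition of (1.4) with its adjoint, an operator on fields on the fine lattice `T^{(i)}`. [cite: Balaban1983RegularityDecay, (1.5) p.572] -/
noncomputable def covProjK (k : ℕ) (T : Site P (i + k) → Site P i → W →ₗ[ℝ] W) (φ : SiteField P i W) : SiteField P i W :=
  covAvgKAdj k T (covAvgK k T φ)

/-- (1.5) unfolded: `P_k = Q_k^* ∘ Q_k`. [cite: Balaban1983RegularityDecay, (1.5) p.572] -/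
theorem covProjK_eq (k : ℕ) (T : Site P (i + k) → Site P i → W →ₗ[ℝ] W) :
    covProjK k T = covAvgKAdj k T ∘ covAvgK k T := rfl

/-- `Q_k^*` IS THE ADJOINT OF `Q_k`: `⟨Q_k φ, ψ⟩_{T^{(i+k)}} = ⟨φ, Q_k^* ψ⟩_{T^{(i)}}` for the `ℓ²` pairings with weights `L^{dk} w`
(coarse) and `w` (fine) — for `w = η^d = L^{-dk}` these are the unit-lattice sum and the `η^d`-weighted sum of (1.4).  Holds for
arbitrary transporters. [cite: Balaban1983RegularityDecay, (1.5) p.572] -/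
theorem l2Inner_covAvgK (k : ℕ) (T : Site P (i + k) → Site P i → W →ₗ[ℝ] W) (w : ℝ) (φ : SiteField P i W)
    (ψ : SiteField P (i + k) W) :
    l2Inner (((P.L : ℝ) ^ P.d) ^ k * w) Finset.univ (covAvgK k T φ) ψ
      = l2Inner w Finset.univ φ (covAvgKAdj k T ψ) := by
  have hc : ((P.L : ℝ) ^ P.d) ^ k ≠ 0 := pow_ne_zero _ (pow_ne_zero _ (Nat.cast_ne_zero.mpr P.L_pos.ne'))
  unfold l2Inner covAvgK covAvgKAdj
  simp only [real_inner_smul_left, sum_inner, LinearMap.adjoint_inner_right]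
  rw [sum_eq_sum_blockJ k (fun x => w * ⟪T (blockOfIter k x) x (φ x), ψ (blockOfIter k x)⟫_ℝ)]
  refine Finset.sum_congr rfl fun y _ => ?_
  rw [← mul_assoc, mul_comm (((P.L : ℝ) ^ P.d) ^ k) w, mul_inv_cancel_right₀ hc, Finset.mul_sum]
  refine Finset.sum_congr rfl fun x hx => ?_
  rw [mem_blockJ] at hx
  rw [hx]

/-- The same identity in [B4]'s normalisation: weight `1` on the unit lattice `Z^d`, weight `η^d = L^{-dk}` on `ηZ^d`. [cite: Balaban1983RegularityDecay, (1.5) p.572] -/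
theorem l2Inner_covAvgK_unit (k : ℕ) (T : Site P (i + k) → Site P i → W →ₗ[ℝ] W) (φ : SiteField P i W)
    (ψ : SiteField P (i + k) W) :
    l2Inner 1 Finset.univ (covAvgK k T φ) ψ = l2Inner ((((P.L : ℝ) ^ P.d) ^ k)⁻¹) Finset.univ φ (covAvgKAdj k T ψ) := by
  have hc : ((P.L : ℝ) ^ P.d) ^ k ≠ 0 := pow_ne_zero _ (pow_ne_zero _ (Nat.cast_ne_zero.mpr P.L_pos.ne'))
  rw [← l2Inner_covAvgK k T _ φ ψ, mul_inv_cancel₀ hc]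

/-- `⟨φ, P_k φ'⟩ = ⟨Q_k φ, Q_k φ'⟩`: the form of `P_k = Q_k^* Q_k` (print's V2 twin: `B4GaugeCovariance.projOp_form`). [cite: Balaban1983RegularityDecay, (1.5) p.572] -/
theorem l2Inner_covProjK (k : ℕ) (T : Site P (i + k) → Site P i → W →ₗ[ℝ] W) (w : ℝ) (φ φ' : SiteField P i W) :
    l2Inner w Finset.univ φ (covProjK k T φ')
      = l2Inner (((P.L : ℝ) ^ P.d) ^ k * w) Finset.univ (covAvgK k T φ) (covAvgK k T φ') :=
  (l2Inner_covAvgK k T w φ (covAvgK k T φ')).symm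

/-- `P_k` IS SYMMETRIC: `⟨P_k φ, φ'⟩ = ⟨φ, P_k φ'⟩`. [cite: Balaban1983RegularityDecay, (1.5) p.572] -/
theorem l2Inner_covProjK_comm (k : ℕ) (T : Site P (i + k) → Site P i → W →ₗ[ℝ] W) (w : ℝ) (φ φ' : SiteField P i W) :
    l2Inner w Finset.univ (covProjK k T φ) φ' = l2Inner w Finset.univ φ (covProjK k T φ') := by
  rw [l2Inner_comm, l2Inner_covProjK, l2Inner_covProjK, l2Inner_comm]

/-- `P_k` IS NONNEGATIVE: `⟨φ, P_k φ⟩ = ‖Q_k φ‖² ≥ 0` (weight `w ≥ 0`). [cite: Balaban1983RegularityDecay, (1.5) p.572] -/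
theorem l2Inner_covProjK_self (k : ℕ) (T : Site P (i + k) → Site P i → W →ₗ[ℝ] W) (w : ℝ) (φ : SiteField P i W) :
    l2Inner w Finset.univ φ (covProjK k T φ) = l2NormSq (((P.L : ℝ) ^ P.d) ^ k * w) Finset.univ (covAvgK k T φ) := by
  rw [l2Inner_covProjK, l2Inner_self]

/-- `⟨φ, P_k φ⟩ ≥ 0` for a nonnegative weight. [cite: Balaban1983RegularityDecay, (1.5) p.572] -/
theorem l2Inner_covProjK_self_nonneg (k : ℕ) (T : Site P (i + k) → Site P i → W →ₗ[ℝ] W) {w : ℝ} (hw : 0 ≤ w)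
    (φ : SiteField P i W) : 0 ≤ l2Inner w Finset.univ φ (covProjK k T φ) := by
  rw [l2Inner_covProjK_self]
  exact l2NormSq_nonneg (mul_nonneg (by positivity) hw) _ _

/-- `Q_k Q_k^* = 1` FOR ORTHOGONAL TRANSPORTERS (`T^* T = 1`, i.e. (1.2): `U(A)` is orthogonal since `q` is antisymmetric), in
the standing range `i + k ≤ m + K` (where `|B^k(y)| = L^{dk}`, so that `Σ_{x ∈ B^k(y)} η^d = 1`). [cite: Balaban1983RegularityDecay, (1.5) p.572] -/
theorem covAvgK_covAvgKAdj {k : ℕ} (hk : i + k ≤ P.m + P.K) (T : Site P (i + k) → Site P i → W →ₗ[ℝ] W)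
    (hT : ∀ (y : Site P (i + k)) (x : Site P i), LinearMap.adjoint (T y x) ∘ₗ T y x = LinearMap.id)
    (ψ : SiteField P (i + k) W) : covAvgK k T (covAvgKAdj k T ψ) = ψ := by
  have hc : ((P.L : ℝ) ^ P.d) ^ k ≠ 0 := pow_ne_zero _ (pow_ne_zero _ (Nat.cast_ne_zero.mpr P.L_pos.ne'))
  funext y
  unfold covAvgK covAvgKAdj
  have h1 : ∑ x ∈ blockJ k y, T y x (LinearMap.adjoint (T (blockOfIter k x) x) (ψ (blockOfIter k x)))
      = ∑ x ∈ blockJ k y, ψ y := by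
    refine Finset.sum_congr rfl fun x hx => ?_
    rw [mem_blockJ] at hx
    rw [hx]
    simpa using LinearMap.congr_fun (comp_adjoint_eq_id (hT y x)) (ψ y)
  rw [h1, Finset.sum_const, card_blockJ k hk y, ← Nat.cast_smul_eq_nsmul ℝ, smul_smul, Nat.cast_pow, Nat.cast_pow,
    inv_mul_cancel₀ hc, one_smul]

/-- `P_k P_k = P_k`: with `Q_k Q_k^* = 1`, `P_k` is idempotent — a PROJECTION, as (1.5) names it. [cite: Balaban1983RegularityDecay, (1.5) p.572] -/
theorem covProjK_idem {k : ℕ} (hk : i + k ≤ P.m + P.K) (T : Site P (i + k) → Site P i → W →ₗ[ℝ] W)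
    (hT : ∀ (y : Site P (i + k)) (x : Site P i), LinearMap.adjoint (T y x) ∘ₗ T y x = LinearMap.id)
    (φ : SiteField P i W) : covProjK k T (covProjK k T φ) = covProjK k T φ := by
  unfold covProjK
  rw [covAvgK_covAvgKAdj hk T hT]

/-- `P_k Q_k^* = Q_k^*`: `P_k` fixes the range of `Q_k^*` (the block-covariantly-constant fields). [cite: Balaban1983RegularityDecay, (1.5) p.572] -/
theorem covProjK_covAvgKAdj {k : ℕ} (hk : i + k ≤ P.m + P.K) (T : Site P (i + k) → Site P i → W →ₗ[ℝ] W)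
    (hT : ∀ (y : Site P (i + k)) (x : Site P i), LinearMap.adjoint (T y x) ∘ₗ T y x = LinearMap.id)
    (ψ : SiteField P (i + k) W) : covProjK k T (covAvgKAdj k T ψ) = covAvgKAdj k T ψ := by
  unfold covProjK
  rw [covAvgK_covAvgKAdj hk T hT]

/-- `Q_k P_k = Q_k`: averaging does not see the fluctuation part `(1 − P_k)φ`. [cite: Balaban1983RegularityDecay, (1.5) p.572] -/
theorem covAvgK_covProjK {k : ℕ} (hk : i + k ≤ P.m + P.K) (T : Site P (i + k) → Site P i → W →ₗ[ℝ] W)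
    (hT : ∀ (y : Site P (i + k)) (x : Site P i), LinearMap.adjoint (T y x) ∘ₗ T y x = LinearMap.id)
    (φ : SiteField P i W) : covAvgK k T (covProjK k T φ) = covAvgK k T φ := by
  unfold covProjK
  rw [covAvgK_covAvgKAdj hk T hT]

end Operators

/-! ## 3. [B4]'s transporters: a vector field `A`, the representation `U`, the staircase contours from the centre; `k = 1` is
`LatticeFieldCalculus.covSiteAvg` -/

section VectorField

variable {P : Params} {i : ℕ} {W : Type*} [NormedAddCommGroup W] [InnerProductSpace ℝ W]

/-- [B4]'s parallel transporters `U(A(Γ^{(k)}_{y,x}))` of (1.4): `A(Γ) = Σ_{b ⊂ Γ} A_b` summed along the STAIRCASE contour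
(`LatticeFieldCalculus.stairSum`, [Balaban1984PropagatorsI] (1.7)) from the initial point `y` (`embIter k y`) to `x`, through the
representation `Urep` (`U(A) = e^{qeηA}` of (1.2), as in `LatticeFieldCalculus.covSiteAvg`).  For `x ∈ B^k(y)` (standing range) the
coordinate displacements are `< L^k/2 <` half the period, so the staircase stays in `B^k(y)` as (1.4) requires. [cite: Balaban1983RegularityDecay, (1.4) p.572] -/
noncomputable def stairTransport (k : ℕ) (Urep : ℝ → W →ₗ[ℝ] W) (A : VecField P i ℝ) :
    Site P (i + k) → Site P i → W →ₗ[ℝ] W :=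
  fun y x => Urep (stairSum A (embIter k y) x)

/-- THE ORDER-ONE CASE IS THE TREE'S `covSiteAvg`: `Q(A)φ = Q_1(A)φ` with the staircase transporters (standing range
`i + 1 ≤ m + K`, where the offset parametrisation `Site.blockSite y r` of `covSiteAvg` runs exactly over `B(y)`). [cite: Balaban1983RegularityDecay, (1.4) p.572] -/
theorem covSiteAvg_eq_covAvgK (hi : i + 1 ≤ P.m + P.K) (Urep : ℝ → W →ₗ[ℝ] W) (A : VecField P i ℝ) (φ : SiteField P i W) :
    covSiteAvg Urep A φ = covAvgK 1 (stairTransport 1 Urep A) φ := by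
  funext y
  unfold covSiteAvg covAvgK stairTransport
  rw [pow_one, blockJ_one, embIter_succ, embIter_zero]
  congr 1
  have hmem : ∀ x : Site P i, blockOf x = y ↔ x ∈ block y := fun x => by simp [block]
  let e : (Fin P.d → Fin P.L) ≃ ↥(block y) := (Site.blockEquiv hi y).symm.trans (Equiv.subtypeEquivRight hmem)
  rw [← Finset.sum_coe_sort (block y), ← Equiv.sum_comp e]
  exact Finset.sum_congr rfl fun r _ => rfl

variable [FiniteDimensional ℝ W]

/-- THE ADJOINT `Q^*(A)` OF THE ONE-LEVEL COVARIANT AVERAGE `LatticeFieldCalculus.covSiteAvg` ((1.4), `k = 1`):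
`(Q^*(A)ψ)(x) = U(A(Γ_{y_x,x}))^* ψ(y_x)`, `y_x = blockOf x`, `Γ_{y_x,x}` the staircase from the block centre. [cite: Balaban1983RegularityDecay, (1.5) p.572] -/
noncomputable def covSiteAvgAdj (Urep : ℝ → W →ₗ[ℝ] W) (A : VecField P i ℝ) (ψ : SiteField P (i + 1) W) : SiteField P i W :=
  covAvgKAdj 1 (stairTransport 1 Urep A) ψ

/-- `covSiteAvgAdj` pointwise: `(Q^*(A)ψ)(x) = U(A(Γ_{blockOf x, x}))^* ψ(blockOf x)`. [cite: Balaban1983RegularityDecay, (1.5) p.572] -/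
theorem covSiteAvgAdj_apply (Urep : ℝ → W →ₗ[ℝ] W) (A : VecField P i ℝ) (ψ : SiteField P (i + 1) W) (x : Site P i) :
    covSiteAvgAdj Urep A ψ x = LinearMap.adjoint (Urep (stairSum A (emb (blockOf x)) x)) (ψ (blockOf x)) := rfl

/-- **(1.5)** for `k = 1` on the tree's operator: `P(A) = Q^*(A) Q(A)` with `Q(A) = LatticeFieldCalculus.covSiteAvg`. [cite: Balaban1983RegularityDecay, (1.5) p.572] -/
noncomputable def covSiteProj (Urep : ℝ → W →ₗ[ℝ] W) (A : VecField P i ℝ) (φ : SiteField P i W) : SiteField P i W :=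
  covSiteAvgAdj Urep A (covSiteAvg Urep A φ)

/-- In the standing range `P(A)` is the order-one case of `covProjK`. [cite: Balaban1983RegularityDecay, (1.5) p.572] -/
theorem covSiteProj_eq_covProjK (hi : i + 1 ≤ P.m + P.K) (Urep : ℝ → W →ₗ[ℝ] W) (A : VecField P i ℝ) (φ : SiteField P i W) :
    covSiteProj Urep A φ = covProjK 1 (stairTransport 1 Urep A) φ := by
  unfold covSiteProj covSiteAvgAdj covProjK
  rw [covSiteAvg_eq_covAvgK hi]

/-- `Q^*(A)` is the adjoint of `covSiteAvg`: `⟨Q(A)φ, ψ⟩_{L^d w} = ⟨φ, Q^*(A)ψ⟩_w` (standing range). [cite: Balaban1983RegularityDecay, (1.5) p.572] -/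
theorem l2Inner_covSiteAvg (hi : i + 1 ≤ P.m + P.K) (Urep : ℝ → W →ₗ[ℝ] W) (A : VecField P i ℝ) (w : ℝ)
    (φ : SiteField P i W) (ψ : SiteField P (i + 1) W) :
    l2Inner ((P.L : ℝ) ^ P.d * w) Finset.univ (covSiteAvg Urep A φ) ψ
      = l2Inner w Finset.univ φ (covSiteAvgAdj Urep A ψ) := by
  rw [covSiteAvg_eq_covAvgK hi, ← pow_one ((P.L : ℝ) ^ P.d)]
  exact l2Inner_covAvgK 1 _ w φ ψ

/-- `Q(A) Q^*(A) = 1` for an ORTHOGONAL representation (`U(a)^* U(a) = 1` for all `a`: (1.2), `q` antisymmetric), standing range. [cite: Balaban1983RegularityDecay, (1.5) p.572] -/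
theorem covSiteAvg_covSiteAvgAdj (hi : i + 1 ≤ P.m + P.K) (Urep : ℝ → W →ₗ[ℝ] W)
    (hU : ∀ a : ℝ, LinearMap.adjoint (Urep a) ∘ₗ Urep a = LinearMap.id) (A : VecField P i ℝ)
    (ψ : SiteField P (i + 1) W) : covSiteAvg Urep A (covSiteAvgAdj Urep A ψ) = ψ := by
  rw [covSiteAvg_eq_covAvgK hi]
  exact covAvgK_covAvgKAdj hi _ (fun y x => hU _) ψ

/-- `P(A) P(A) = P(A)`: the one-level `P(A)` is a projection (orthogonal `U`, standing range). [cite: Balaban1983RegularityDecay, (1.5) p.572] -/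
theorem covSiteProj_idem (hi : i + 1 ≤ P.m + P.K) (Urep : ℝ → W →ₗ[ℝ] W)
    (hU : ∀ a : ℝ, LinearMap.adjoint (Urep a) ∘ₗ Urep a = LinearMap.id) (A : VecField P i ℝ) (φ : SiteField P i W) :
    covSiteProj Urep A (covSiteProj Urep A φ) = covSiteProj Urep A φ := by
  unfold covSiteProj
  rw [covSiteAvg_covSiteAvgAdj hi Urep hU]

/-- `⟨φ, P(A)φ'⟩_w = ⟨Q(A)φ, Q(A)φ'⟩_{L^d w}` for the one-level operators (standing range). [cite: Balaban1983RegularityDecay, (1.5) p.572] -/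
theorem l2Inner_covSiteProj (hi : i + 1 ≤ P.m + P.K) (Urep : ℝ → W →ₗ[ℝ] W) (A : VecField P i ℝ) (w : ℝ)
    (φ φ' : SiteField P i W) :
    l2Inner w Finset.univ φ (covSiteProj Urep A φ')
      = l2Inner ((P.L : ℝ) ^ P.d * w) Finset.univ (covSiteAvg Urep A φ) (covSiteAvg Urep A φ') :=
  (l2Inner_covSiteAvg hi Urep A w φ (covSiteAvg Urep A φ')).symm

/-- The one-level `P(A)` is symmetric (standing range). [cite: Balaban1983RegularityDecay, (1.5) p.572] -/
theorem l2Inner_covSiteProj_comm (hi : i + 1 ≤ P.m + P.K) (Urep : ℝ → W →ₗ[ℝ] W) (A : VecField P i ℝ) (w : ℝ)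
    (φ φ' : SiteField P i W) :
    l2Inner w Finset.univ (covSiteProj Urep A φ) φ' = l2Inner w Finset.univ φ (covSiteProj Urep A φ') := by
  rw [l2Inner_comm, l2Inner_covSiteProj hi, l2Inner_covSiteProj hi, l2Inner_comm]

end VectorField

end B4Eq15Projection

end Literature.MathematicalPhysics.QuantumFieldTheory.Balaban1983to89
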